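import Summits.CriticalPhenomena.PercolationContinuityZ3.Theorems.PercNearOneGluingNoHeavyLowerTailKnQuestion8CoefficientwiseCoreClassKernelMixFibreInjection
import Summits.CriticalPhenomena.PercolationContinuityZ3.Theorems.PercNearOneGluingNoHeavyLowerTailKnQuestion8CoefficientwiseCoreClassKernelMixFibreUpset
import Summits.CriticalPhenomena.PercolationContinuityZ3.Theorems.PercNearOneGluingNoHeavyLowerTailKnQuestion8CoefficientwiseCoreClassKernelMixSigmaFlip
import Summits.CriticalPhenomena.PercolationContinuityZ3.Theorems.PercNearOneGluingNoHeavyLowerTailKnQuestion8CoefficientwiseCoreClassKernelMixTwoArcAssembly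
import HarnessLib

/-!
# IET on a two-arc edge set, II: the fibre inequalities from four cluster facts (THEOREM IET-CYCLE modulo the arc)

Support file (`--supports stmt-CriticalPhenomena-4575`, closed), prover `prim-cplus-coupling` (gen 39).  No definitions, no notations, no named facts,
no sorries; standard axioms.  Memo `prim-cplus-coupling/A5-COUPLING-gen39.md` §2–§3.

This file does all the GENERIC work between the abstract fibre lemmas (`…KernelMixFibreInjection`, `…KernelMixFibreUpset`), the partial swap
(`…KernelMixSigmaFlip`) and the assembly (`…KernelMixTwoArcAssembly`): for a 'free arc' `A` and a 'blue arc' `W` (disjoint, nonempty, `E = A ∪ W`)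
it instantiates `X η = C_u η`, `Y η = C_u(E ∖ η)`, `G ζ = C_u(ζ ∪ W)`, `X₀ = {u}`, `σ` = the partial swap of `A`, `T m` = a given suffix chain of `A`,
`J m = C_u(W ∪ T m)`, `jb, jr` = `Nat.findGreatest`, and discharges every hypothesis of the two fibre lemmas EXCEPT four facts about clusters on the
cycle, which it takes as hypotheses:
 (R)  `b ∈ C_u(A)` and `b ∉ C_u(η)` for `η ⊊ A` (the only `u–b` routes are the arcs);
 (G⋆) `C_u((A ∖ T 1) ∪ W) = C_u(A ∪ W)` (dropping the last edge of the free arc keeps the cycle connected);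
 (YJ) for `η ⊊ A` with `C_u η ≠ {u}`: `C_u(E ∖ η) ⊆ C_u(W ∪ T (jb η))` (the blue cluster is `W` plus the terminal blue run);
 (Yσ) for the same `η`: `C_u(E ∖ η) ⊆ C_u(σ(η) ∪ W)` (the partial swap red-connects the blue cluster).
* `Coefficientwise.twoArc_fibre_inequalities` — (R), (G⋆), (YJ), (Yσ) for the pair `(A, W)` ⟹ the FIBRE INJECTION and FIBRE UP-SET inequalities
  for the free arc `A`, in the form consumed by `iet_twoArc_assembly`.
* `Coefficientwise.iet_twoArc_of_clusterFacts` — both pairs `(W₂, W₁)`, `(W₁, W₂)` + the two-route property ⟹ IET for every up-closed `𝒱`.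
What remains for THEOREM IET-CYCLE in the kernel is to verify (R), (G⋆), (YJ), (Yσ) on an explicit cycle (path induction along the arcs).
[cite: KozmaNitzan2024, Questions 8–9 (§5.5 p. 36) (context: the Question-8 pocket covariance programme)]
-/

namespace Summit.CriticalPhenomena.PercolationContinuityZ3.Theorems

open Finset Literature.Probability.Percolation

namespace Coefficientwise

variable {ι V : Type*}

open Classical in
/-- **The two fibre inequalities of a free arc from four cluster facts.**  See the module docstring for (R), (G⋆), (YJ), (Yσ); `T` is a chain
`∅ = T 0 ⊆ T 1 ⊆ ⋯` of subsets of `A` with `T 1 ≠ ∅`, `jb η = Nat.findGreatest (fun m => Disjoint η (T m)) N`, and `σ(η) = (η ∩ In) ∪ (Out ∖ η)`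
with `In = {e ∈ A : ∀ x ∈ e, x ∈ C_u η}`, `Out = {e ∈ A : ∀ x ∈ e, x ∉ C_u η}`.  Conclusion: the conjunction of
(FI) `∀ F ⊆ 2^A` with `∅ ∉ F`: `0 ≤ Σ_{F∖{A}} T + Σ_{ζ ⊆ A, ζ ∉ {∅,A}} hk(C_u(ζ ∪ W))` and
(FU) `∀` up-closed `F ∋ A`: `0 ≤ Σ_{F∖{A}} T + Σ_{ζ ∈ F∖{∅}} hk(C_u(ζ ∪ W))`, where `T(η) = (hᵃ(C_uη) − hᵇ(C_u(E∖η)))(kᵃ(C_uη) − kᵇ(C_u(E∖η)))`.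
[cite: KozmaNitzan2024, Questions 8–9 (§5.5 p. 36) (context)] -/
theorem twoArc_fibre_inequalities (ends : ι → Sym2 V) (A W E : Finset ι) (hE : E = A ∪ W) (hAW : Disjoint A W)
    (hA : A.Nonempty) (u b : V)
    (hbA : b ∈ openCluster (ends '' (↑A : Set ι)) u)
    (hbη : ∀ η : Finset ι, η ⊆ A → η ≠ A → b ∉ openCluster (ends '' (↑η : Set ι)) u)
    (N : ℕ) (T : ℕ → Finset ι) (hT0 : T 0 = ∅) (hTmono : ∀ m m', m ≤ m' → T m ⊆ T m') (hTA : ∀ m, T m ⊆ A) (hT1 : (T 1).Nonempty)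
    (hGstar : openCluster (ends '' (↑((A \ T 1) ∪ W) : Set ι)) u = openCluster (ends '' (↑(A ∪ W) : Set ι)) u)
    (hYJ : ∀ η : Finset ι, η ⊆ A → η ≠ A → openCluster (ends '' (↑η : Set ι)) u ≠ {u} →
      openCluster (ends '' (↑(E \ η) : Set ι)) u
        ⊆ openCluster (ends '' (↑(W ∪ T (Nat.findGreatest (fun m => Disjoint η (T m)) N)) : Set ι)) u)
    (hYσ : ∀ η : Finset ι, η ⊆ A → η ≠ A → openCluster (ends '' (↑η : Set ι)) u ≠ {u} →
      openCluster (ends '' (↑(E \ η) : Set ι)) u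
        ⊆ openCluster (ends '' (↑(((η ∩ A.filter (fun e => ∀ x, x ∈ ends e → x ∈ openCluster (ends '' (↑η : Set ι)) u))
            ∪ (A.filter (fun e => ∀ x, x ∈ ends e → x ∉ openCluster (ends '' (↑η : Set ι)) u) \ η)) ∪ W) : Set ι)) u)
    (h k ha hb ka kb : Set V → ℝ)
    (hh : Monotone h) (hk : Monotone k) (mha : Monotone ha) (mhb : Monotone hb) (mka : Monotone ka) (mkb : Monotone kb)
    (ha0 : ∀ S, 0 ≤ ha S) (hah : ∀ S, ha S ≤ h S) (hb0 : ∀ S, 0 ≤ hb S) (hbh : ∀ S, hb S ≤ h S)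
    (ka0 : ∀ S, 0 ≤ ka S) (kak : ∀ S, ka S ≤ k S) (kb0 : ∀ S, 0 ≤ kb S) (kbk : ∀ S, kb S ≤ k S) :
    (∀ F : Finset (Finset ι), (∀ η ∈ F, η ⊆ A) → ∅ ∉ F →
      0 ≤ (∑ η ∈ F.erase A, (ha (openCluster (ends '' (↑η : Set ι)) u) - hb (openCluster (ends '' (↑(E \ η) : Set ι)) u)) *
            (ka (openCluster (ends '' (↑η : Set ι)) u) - kb (openCluster (ends '' (↑(E \ η) : Set ι)) u)))
        + ∑ ζ ∈ (A.powerset.erase ∅).erase A, h (openCluster (ends '' (↑(ζ ∪ W) : Set ι)) u) * k (openCluster (ends '' (↑(ζ ∪ W) : Set ι)) u))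
    ∧ (∀ F : Finset (Finset ι), (∀ η ∈ F, η ⊆ A) → (∀ η ∈ F, ∀ ζ : Finset ι, η ⊆ ζ → ζ ⊆ A → ζ ∈ F) → A ∈ F →
      0 ≤ (∑ η ∈ F.erase A, (ha (openCluster (ends '' (↑η : Set ι)) u) - hb (openCluster (ends '' (↑(E \ η) : Set ι)) u)) *
            (ka (openCluster (ends '' (↑η : Set ι)) u) - kb (openCluster (ends '' (↑(E \ η) : Set ι)) u)))
        + ∑ ζ ∈ F.erase ∅, h (openCluster (ends '' (↑(ζ ∪ W) : Set ι)) u) * k (openCluster (ends '' (↑(ζ ∪ W) : Set ι)) u)) := by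
  set C : Finset ι → Set V := fun ω => openCluster (ends '' (↑ω : Set ι)) u with hC
  have huC : ∀ ω, u ∈ C ω := fun ω => mem_openCluster_self _ _
  have hu0 : ∀ ω, ({u} : Set V) ⊆ C ω := fun ω => Set.singleton_subset_iff.mpr (huC ω)
  have hCmono : ∀ {ω ω' : Finset ι}, ω ⊆ ω' → C ω ⊆ C ω' := fun hle => openCluster_image_mono ends hle u
  -- E \ η = (A \ η) ∪ W for η ⊆ A
  have hEη : ∀ η : Finset ι, η ⊆ A → E \ η = (A \ η) ∪ W := by
    intro η hη
    rw [hE]; ext i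
    simp only [Finset.mem_sdiff, Finset.mem_union]
    constructor
    · rintro ⟨hi | hi, hni⟩
      · exact Or.inl ⟨hi, hni⟩
      · exact Or.inr hi
    · rintro (⟨hi, hni⟩ | hi)
      · exact ⟨Or.inl hi, hni⟩
      · exact ⟨Or.inr hi, fun hiη => Finset.disjoint_left.mp hAW (hη hiη) hi⟩
  have hYc : ∀ η : Finset ι, η ⊆ A → C (E \ η) ⊆ C ((A \ η) ∪ W) := fun η hη => by rw [hEη η hη]
  -- a nontrivial red cluster has a red edge at u
  have hedge : ∀ η : Finset ι, C η ≠ {u} → ∃ e ∈ η, ∃ x, x ∈ ends e ∧ x ∈ C η := by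
    intro η hne
    by_contra hno
    apply hne
    exact openCluster_eq_singleton_of_no_edge_at ends η fun i hi hui => hno ⟨i, hi, u, hui, huC η⟩
  -- (FI) via the fibre injection lemma with the partial swap σ
  have FI : ∀ F : Finset (Finset ι), (∀ η ∈ F, η ⊆ A) → ∅ ∉ F →
      0 ≤ (∑ η ∈ F.erase A, (ha (C η) - hb (C (E \ η))) * (ka (C η) - kb (C (E \ η))))
        + ∑ ζ ∈ (A.powerset.erase ∅).erase A, h (C (ζ ∪ W)) * k (C (ζ ∪ W)) := by
    intro F hFA hF0
    refine fibreInjection_transfer A F hFA hF0 (fun η => C η) (fun η => C (E \ η)) (fun ζ => C (ζ ∪ W)) {u}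
      (fun η _ => hu0 η) (fun ζ _ => hu0 _) (fun η hη => hYc η (hFA η hη))
      (fun η => (η ∩ A.filter (fun e => ∀ x, x ∈ ends e → x ∈ C η)) ∪ (A.filter (fun e => ∀ x, x ∈ ends e → x ∉ C η) \ η))
      ?_ ?_ ?_ ?_ h k ha hb ka kb hh hk mha mhb mka mkb ha0 hah hb0 hbh ka0 kak kb0 kbk
    · -- values in 2^A ∖ {∅, A}
      intro η hη hηA hx
      refine ⟨?_, ?_, ?_⟩
      · exact Finset.union_subset (le_trans Finset.inter_subset_left (hFA η hη))
          (le_trans Finset.sdiff_subset (Finset.filter_subset _ _))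
      · exact sigmaFlip_ne_empty ends A η u (hFA η hη) (hedge η hx)
      · exact sigmaFlip_ne_top ends A η u b hbA (hbη η (hFA η hη) hηA)
    · -- injective
      intro η₁ hη₁ η₂ hη₂ _ _ _ _ heq
      have h1 := hFA η₁ hη₁; have h2 := hFA η₂ hη₂
      have c1 := openCluster_sigmaFlip ends A η₁ u h1
      have c2 := openCluster_sigmaFlip ends A η₂ u h2
      have hC12 : C η₁ = C η₂ := by
        have : C ((η₁ ∩ A.filter (fun e => ∀ x, x ∈ ends e → x ∈ C η₁)) ∪ (A.filter (fun e => ∀ x, x ∈ ends e → x ∉ C η₁) \ η₁))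
            = C ((η₂ ∩ A.filter (fun e => ∀ x, x ∈ ends e → x ∈ C η₂)) ∪ (A.filter (fun e => ∀ x, x ∈ ends e → x ∉ C η₂) \ η₂)) := by
          rw [heq]
        simp only [hC] at this c1 c2 ⊢
        rw [c1, c2] at this
        exact this
      have e1 := sigmaFlip_sigmaFlip ends A η₁ u h1
      have e2 := sigmaFlip_sigmaFlip ends A η₂ u h2
      simp only [hC] at heq hC12 e1 e2
      rw [heq] at e1
      rw [hC12] at e1
      exact e1.symm.trans e2
    · -- covers the red cluster
      intro η hη _ _
      have c1 := openCluster_sigmaFlip ends A η u (hFA η hη)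
      exact c1.symm.le.trans (openCluster_image_mono ends Finset.subset_union_left u)
    · -- covers the blue cluster (cluster fact Yσ)
      intro η hη hηA hx
      exact hYσ η (hFA η hη) hηA hx
  -- (FU) via the fibre up-set lemma with the suffix chain
  have FU : ∀ F : Finset (Finset ι), (∀ η ∈ F, η ⊆ A) → (∀ η ∈ F, ∀ ζ : Finset ι, η ⊆ ζ → ζ ⊆ A → ζ ∈ F) → A ∈ F →
      0 ≤ (∑ η ∈ F.erase A, (ha (C η) - hb (C (E \ η))) * (ka (C η) - kb (C (E \ η))))
        + ∑ ζ ∈ F.erase ∅, h (C (ζ ∪ W)) * k (C (ζ ∪ W)) := by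
    intro F hFA hFup hAF
    refine fibreUpset_transfer A hA F hFA hFup hAF (fun η => C η) (fun η => C (E \ η)) (fun ζ => C (ζ ∪ W)) {u}
      ?_ (fun η _ => hu0 η) (fun η ζ hηζ _ => hCmono hηζ) (fun ζ _ => hCmono Finset.subset_union_left)
      (fun ζ ζ' hζ _ => hCmono (Finset.union_subset_union hζ (le_refl W))) (fun η hη => hYc η hη)
      N T hT0 hTmono hTA hT1 ?_ (fun m => C (W ∪ T m)) (fun m m' hmm' => hCmono (Finset.union_subset_union (le_refl W) (hTmono m m' hmm')))
      (fun ζ => Nat.findGreatest (fun m => T m ⊆ ζ) N) (fun ζ _ => Nat.findGreatest_le N) ?_ ?_ ?_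
      (fun η => Nat.findGreatest (fun m => Disjoint η (T m)) N) (fun η _ _ _ => Nat.findGreatest_le N) ?_ ?_
      h k ha hb ka kb hh hk mha mhb mka mkb ha0 hah hb0 hbh ka0 kak kb0 kbk
    · -- X ∅ = {u}
      show C ∅ = {u}
      exact openCluster_eq_singleton_of_no_edge_at ends ∅ fun i hi _ => absurd hi (Finset.notMem_empty i)
    · -- G (A \ T 1) = G A
      show C ((A \ T 1) ∪ W) = C (A ∪ W)
      exact hGstar
    · -- T m ⊆ ζ → m ≤ jr ζ
      intro ζ _ m hmN hTm
      exact Nat.le_findGreatest hmN hTm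
    · -- J (jr ζ) ⊆ G ζ
      intro ζ _
      have hsub : T (Nat.findGreatest (fun m => T m ⊆ ζ) N) ⊆ ζ :=
        Nat.findGreatest_spec (P := fun m => T m ⊆ ζ) (Nat.zero_le N) (by rw [hT0]; exact Finset.empty_subset ζ)
      show C (W ∪ T (Nat.findGreatest (fun m => T m ⊆ ζ) N)) ⊆ C (ζ ∪ W)
      exact hCmono (Finset.union_subset Finset.subset_union_right (le_trans hsub Finset.subset_union_left))
    · -- J N ⊆ G A
      show C (W ∪ T N) ⊆ C (A ∪ W)
      exact hCmono (Finset.union_subset Finset.subset_union_right (le_trans (hTA N) Finset.subset_union_left))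
    · -- Disjoint η (T (jb η))
      intro η _ _ _
      exact Nat.findGreatest_spec (P := fun m => Disjoint η (T m)) (Nat.zero_le N) (by rw [hT0]; exact Finset.disjoint_empty_right η)
    · -- Y η ⊆ J (jb η)  (cluster fact YJ)
      intro η hη hηA hx
      exact hYJ η (hFA η hη) hηA hx
  exact ⟨FI, FU⟩

open Classical in
/-- **THEOREM IET-CYCLE modulo the arc combinatorics.**  `W₁, W₂` disjoint nonempty edge sets with the two-route property
`b ∈ C_u ω ↔ W₁ ⊆ ω ∨ W₂ ⊆ ω` (`ω ⊆ W₁ ∪ W₂`), suffix chains `T₂` of `W₂` and `T₁` of `W₁`, and the cluster facts (G⋆), (YJ), (Yσ) for both pairs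
(free arc, blue arc) = `(W₂, W₁)` and `(W₁, W₂)`.  Then CONJECTURE IET holds on `W₁ ∪ W₂` for EVERY up-closed `𝒱` and all admissible levels.
[cite: KozmaNitzan2024, Questions 8–9 (§5.5 p. 36) (context)] -/
theorem iet_twoArc_of_clusterFacts (ends : ι → Sym2 V) (W₁ W₂ : Finset ι) (hW : Disjoint W₁ W₂)
    (hW₁ : W₁.Nonempty) (hW₂ : W₂.Nonempty) (u b : V)
    (hroute : ∀ ω : Finset ι, ω ⊆ W₁ ∪ W₂ → (b ∈ openCluster (ends '' (↑ω : Set ι)) u ↔ (W₁ ⊆ ω ∨ W₂ ⊆ ω)))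
    (N₂ : ℕ) (T₂ : ℕ → Finset ι) (hT₂0 : T₂ 0 = ∅) (hT₂mono : ∀ m m', m ≤ m' → T₂ m ⊆ T₂ m') (hT₂W : ∀ m, T₂ m ⊆ W₂) (hT₂1 : (T₂ 1).Nonempty)
    (N₁ : ℕ) (T₁ : ℕ → Finset ι) (hT₁0 : T₁ 0 = ∅) (hT₁mono : ∀ m m', m ≤ m' → T₁ m ⊆ T₁ m') (hT₁W : ∀ m, T₁ m ⊆ W₁) (hT₁1 : (T₁ 1).Nonempty)
    (hGstar₂ : openCluster (ends '' (↑((W₂ \ T₂ 1) ∪ W₁) : Set ι)) u = openCluster (ends '' (↑(W₂ ∪ W₁) : Set ι)) u)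
    (hGstar₁ : openCluster (ends '' (↑((W₁ \ T₁ 1) ∪ W₂) : Set ι)) u = openCluster (ends '' (↑(W₁ ∪ W₂) : Set ι)) u)
    (hYJ₂ : ∀ η : Finset ι, η ⊆ W₂ → η ≠ W₂ → openCluster (ends '' (↑η : Set ι)) u ≠ {u} →
      openCluster (ends '' (↑((W₁ ∪ W₂) \ η) : Set ι)) u
        ⊆ openCluster (ends '' (↑(W₁ ∪ T₂ (Nat.findGreatest (fun m => Disjoint η (T₂ m)) N₂)) : Set ι)) u)
    (hYJ₁ : ∀ η : Finset ι, η ⊆ W₁ → η ≠ W₁ → openCluster (ends '' (↑η : Set ι)) u ≠ {u} →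
      openCluster (ends '' (↑((W₁ ∪ W₂) \ η) : Set ι)) u
        ⊆ openCluster (ends '' (↑(W₂ ∪ T₁ (Nat.findGreatest (fun m => Disjoint η (T₁ m)) N₁)) : Set ι)) u)
    (hYσ₂ : ∀ η : Finset ι, η ⊆ W₂ → η ≠ W₂ → openCluster (ends '' (↑η : Set ι)) u ≠ {u} →
      openCluster (ends '' (↑((W₁ ∪ W₂) \ η) : Set ι)) u
        ⊆ openCluster (ends '' (↑(((η ∩ W₂.filter (fun e => ∀ x, x ∈ ends e → x ∈ openCluster (ends '' (↑η : Set ι)) u))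
            ∪ (W₂.filter (fun e => ∀ x, x ∈ ends e → x ∉ openCluster (ends '' (↑η : Set ι)) u) \ η)) ∪ W₁) : Set ι)) u)
    (hYσ₁ : ∀ η : Finset ι, η ⊆ W₁ → η ≠ W₁ → openCluster (ends '' (↑η : Set ι)) u ≠ {u} →
      openCluster (ends '' (↑((W₁ ∪ W₂) \ η) : Set ι)) u
        ⊆ openCluster (ends '' (↑(((η ∩ W₁.filter (fun e => ∀ x, x ∈ ends e → x ∈ openCluster (ends '' (↑η : Set ι)) u))
            ∪ (W₁.filter (fun e => ∀ x, x ∈ ends e → x ∉ openCluster (ends '' (↑η : Set ι)) u) \ η)) ∪ W₂) : Set ι)) u)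
    (𝒱 : Finset ι → Prop) (hV : ∀ ⦃s t : Finset ι⦄, s ⊆ t → 𝒱 s → 𝒱 t)
    (h k ha hb ka kb : Set V → ℝ)
    (hh : Monotone h) (hk : Monotone k) (mha : Monotone ha) (mhb : Monotone hb) (mka : Monotone ka) (mkb : Monotone kb)
    (ha0 : ∀ S, 0 ≤ ha S) (hah : ∀ S, ha S ≤ h S) (hb0 : ∀ S, 0 ≤ hb S) (hbh : ∀ S, hb S ≤ h S)
    (ka0 : ∀ S, 0 ≤ ka S) (kak : ∀ S, ka S ≤ k S) (kb0 : ∀ S, 0 ≤ kb S) (kbk : ∀ S, kb S ≤ k S) :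
    0 ≤ (∑ ω ∈ (W₁ ∪ W₂).powerset, if 𝒱 ω ∧ b ∈ openCluster (ends '' (↑ω : Set ι)) u ∧ b ∉ openCluster (ends '' (↑((W₁ ∪ W₂) \ ω) : Set ι)) u then
        h (openCluster (ends '' (↑ω : Set ι)) u) * k (openCluster (ends '' (↑ω : Set ι)) u) else 0)
      + ∑ ω ∈ (W₁ ∪ W₂).powerset, if 𝒱 ω ∧ b ∈ openCluster (ends '' (↑((W₁ ∪ W₂) \ ω) : Set ι)) u ∧ b ∉ openCluster (ends '' (↑ω : Set ι)) u then
        (ha (openCluster (ends '' (↑ω : Set ι)) u) - hb (openCluster (ends '' (↑((W₁ ∪ W₂) \ ω) : Set ι)) u)) *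
          (ka (openCluster (ends '' (↑ω : Set ι)) u) - kb (openCluster (ends '' (↑((W₁ ∪ W₂) \ ω) : Set ι)) u)) else 0 := by
  -- route consequences
  have hbW₂ : b ∈ openCluster (ends '' (↑W₂ : Set ι)) u := (hroute W₂ Finset.subset_union_right).mpr (Or.inr (le_refl W₂))
  have hbW₁ : b ∈ openCluster (ends '' (↑W₁ : Set ι)) u := (hroute W₁ Finset.subset_union_left).mpr (Or.inl (le_refl W₁))
  have hbη₂ : ∀ η : Finset ι, η ⊆ W₂ → η ≠ W₂ → b ∉ openCluster (ends '' (↑η : Set ι)) u := by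
    intro η hη hne hb'
    rcases (hroute η (le_trans hη Finset.subset_union_right)).mp hb' with h1 | h2
    · obtain ⟨x, hx⟩ := hW₁
      exact Finset.disjoint_left.mp hW hx (hη (h1 hx))
    · exact hne (Finset.Subset.antisymm hη h2)
  have hbη₁ : ∀ η : Finset ι, η ⊆ W₁ → η ≠ W₁ → b ∉ openCluster (ends '' (↑η : Set ι)) u := by
    intro η hη hne hb'
    rcases (hroute η (le_trans hη Finset.subset_union_left)).mp hb' with h1 | h2
    · exact hne (Finset.Subset.antisymm hη h1)
    · obtain ⟨x, hx⟩ := hW₂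
      exact Finset.disjoint_left.mp hW (hη (h2 hx)) hx
  obtain ⟨FI₁, FU₁⟩ := twoArc_fibre_inequalities ends W₂ W₁ (W₁ ∪ W₂) (Finset.union_comm W₁ W₂) hW.symm hW₂ u b hbW₂ hbη₂
    N₂ T₂ hT₂0 hT₂mono hT₂W hT₂1 hGstar₂ hYJ₂ hYσ₂ h k ha hb ka kb hh hk mha mhb mka mkb ha0 hah hb0 hbh ka0 kak kb0 kbk
  obtain ⟨FI₂, FU₂⟩ := twoArc_fibre_inequalities ends W₁ W₂ (W₁ ∪ W₂) rfl hW hW₁ u b hbW₁ hbη₁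
    N₁ T₁ hT₁0 hT₁mono hT₁W hT₁1 hGstar₁ hYJ₁ hYσ₁ h k ha hb ka kb hh hk mha mhb mka mkb ha0 hah hb0 hbh ka0 kak kb0 kbk
  exact iet_twoArc_assembly ends W₁ W₂ hW hW₁ hW₂ u b hroute 𝒱 hV h k ha hb ka kb
    (fun S => le_trans (ha0 S) (hah S)) (fun S => le_trans (ka0 S) (kak S)) FI₁ FU₁ FI₂ FU₂

end Coefficientwise

end Summit.CriticalPhenomena.PercolationContinuityZ3.Theorems
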